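import Literature.AlgebraicGeometry.NeronModels.Dilatation
import Literature.AlgebraicGeometry.Resolution.AffineBlowupUniversal
import Literature.AlgebraicGeometry.Resolution.BlowupAlgebraLift
import Literature.AlgebraicGeometry.Dilatations.AffineDilatationSpec
import HarnessLib

/-!
# Dilatations of schemes: existence in the affine, principal case (MRR §2.3, proof)

Topic: `Literature/AlgebraicGeometry/NeronModels`; sequel of `Dilatation.lean` (`IsDilatation`,
the universal property of Mayeux–Richarz–Romagny §2.3). PROVED over Mathlib: for a ring `A`, an
ideal `I ⊆ A` and `b ∈ A`, the structure morphism of the tree's affine blowup algebra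
(`Resolution.blowupAlgebra I b = A[I/b] ⊆ A[1/b]`, the `A`-subalgebra generated by the `x/b`,
`x ∈ I`; MRR §2.1 "the ring `B[I/b]` is the `B`-subalgebra of `B[b⁻¹]` generated by fractions
`x/b` with `x ∈ I`")

  `π : Spec A[I/b] → Spec A`

**is a dilatation of `Spec A` in `V(I)` along `V(b)`** — `isDilatation_specMap_blowupAlgebra` —
i.e. MRR's construction `Bl_Z^D X = Spec B[I/b]` (§2.1, Definition, affine principal case) has
the universal property of §2.3, Proposition, following the printed proof: (i) `b` is a
non-zero-divisor of `A[I/b]` and (ii) `I·A[I/b] ⊆ b·A[I/b]` (MRR (2.1)–(2.2) = Stacks 07Z3;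
`Resolution.algebraMap_mem_nonZeroDivisors_blowupAlgebra`, `map_blowupAlgebra_le_span`);
(iii) for `f : T → Spec A` such that `T ×_X V(b) ⊆ T` is an effective Cartier divisor contained in
`T ×_X V(I)`: on a Cartier chart `V ⊆ T` (affine, `b·Γ(V) = (u)` with `u` regular, so `b` itself is
regular on `V`) the ring map `A → Γ(V)` sends `I` into `(b)`, hence extends uniquely to `A[I/b]`
("the `b`-torsion freeness of `R` implies that there is a unique element `r ∈ R` such that
`g(x) = bⁿ · r`"; the tree's `Resolution.blowupAlgebra.lift` / `ringHom_ext`), giving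
`V → Spec A[I/b]` over `Spec A`; these local morphisms agree on overlaps by uniqueness and glue
("As (2.6) is a morphism of Zariski sheaves, we reduce to the case where … `T = Spec R` [is]
affine"). No hypothesis `b ∈ I` is needed (for general `b`, `Spec A[I/b]` is the dilatation in
`V(I) ∩ V(b)` along `V(b)`, cf. `isDilatation_sup_iff`).

* `map_blowupAlgebra_le_span` — `I·A[I/b] ⊆ (b)` (no hypothesis on `b`);
* `idealSheaf_comap_specMap` — `Ĩ_J` pulls back along `Spec φ` to `Ĩ_{φ(J)}` (so the divisor
  `V(ϖ) ×_{Spec O} Spec A` of an `O`-algebra is `V(ϖ_A)`);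
* `exists_affineOpens_regular`, `map_le_span_of_comap_le` — the Cartier charts of a test scheme
  and the divisibility `I·Γ(V) ⊆ b·Γ(V)` on its affine opens;
* `spec_hom_ext`, `exists_specLift`, `spec_hom_ext_of_isEffectiveCartier` — uniqueness and local
  existence of morphisms to `Spec A[I/b]` over `Spec A`;
* `isDilatation_specMap_blowupAlgebra` — **`IsDilatation (Spec A[I/b] → Spec A) Ĩ (b)~`**;
* `isDilatation_dilatationSpecMap` — the case `b = ϖ_A` of an `O`-algebra `A` and `ϖ ∈ O`
  (`Dilatations.dilatation.specMap ϖ I`, BLR §3.2: the dilatation of `Y = V(I) ⊆ X_k` in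
  `X = Spec A` over a discrete valuation ring `O` with uniformizer `ϖ`, `D = X_k` the special
  fibre), so that the general theory of `Dilatation.lean` applies to the tree's affine
  dilatations over discrete valuation rings.

## References

* A. Mayeux, T. Richarz, M. Romagny, *Néron blowups and low-degree cohomological applications*,
  arXiv:2001.03597 (2020), §2.1 (Definition; (2.1)–(2.3)), §2.3 (Proposition and its proof).
  [MayeuxRicharzRomagny2020]
* S. Bosch, W. Lütkebohmert, M. Raynaud, *Néron Models*, Springer 1990, §3.2, Prop. 3.2/1.
  [BLRNeronModels1990] (Not held; numbers only.)
* The Stacks Project, Tag 07Z3. [StacksProject]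
-/

noncomputable section

open CategoryTheory CategoryTheory.Limits AlgebraicGeometry TopologicalSpace
open Literature.AlgebraicGeometry.Resolution

namespace Literature.AlgebraicGeometry.NeronModels

universe u

/-! ## Ring-level complements -/

section Ring

variable {A : Type u} [CommRing A] (I : Ideal A) (b : A)

/-- **`I·A[I/b] ⊆ b·A[I/b]`** (MRR (2.2) "`bB[I/b] = IB[I/b]`", the inclusion valid for every
`b`): `x = (x/b)·b` for `x ∈ I`. [cite: MayeuxRicharzRomagny2020, §2.1 (2.2)] -/
theorem map_blowupAlgebra_le_span :
    I.map (algebraMap A (blowupAlgebra I b)) ≤ Ideal.span {algebraMap A (blowupAlgebra I b) b} := by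
  rw [Ideal.map_le_iff_le_comap]
  intro x hx
  rw [Ideal.mem_comap, Ideal.mem_span_singleton']
  exact ⟨⟨_, div_mem_blowupAlgebra I b hx⟩, Subtype.ext (div_mul_algebraMap b x)⟩

/-- Mutual divisibility with a non-zero-divisor: if `(x) = (y)` and `y` is a non-zero-divisor,
so is `x`. [folklore] -/
private theorem mem_nonZeroDivisors_of_span_eq_span {C : Type*} [CommRing C] {x y : C}
    (h : Ideal.span {x} = Ideal.span {y}) (hy : y ∈ nonZeroDivisors C) :
    x ∈ nonZeroDivisors C := by
  obtain ⟨a, rfl⟩ : ∃ a, a * y = x :=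
    Ideal.mem_span_singleton'.mp (h ▸ Ideal.mem_span_singleton_self x)
  obtain ⟨c, hc⟩ : ∃ c, c * (a * y) = y :=
    Ideal.mem_span_singleton'.mp (h.symm ▸ Ideal.mem_span_singleton_self y)
  have hca : c * a = 1 := by
    have h1 : (c * a - 1) * y = 0 := by rw [sub_mul, one_mul, mul_assoc, hc, sub_self]
    exact sub_eq_zero.mp ((mem_nonZeroDivisors_iff_right.mp hy) _ h1)
  exact mul_mem (IsUnit.mem_nonZeroDivisors (isUnit_iff_exists_inv.mpr ⟨c, by rwa [mul_comm] at hca⟩)) hy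

end Ring

/-! ## Ideal sheaves of ideals on `Spec A` under `Spec` of a ring map -/

section IdealSheaf

variable {R A : Type u} [CommRing R] [CommRing A] (φ : R →+* A) (J : Ideal R)

/-- The ring map of `Spec φ` on global sections, through `Γ(Spec -, 𝒪) ≅ -`, is `φ`:
`(Spec φ)^* ∘ ι_R = ι_A ∘ φ` for the inverses `ι` of `Scheme.ΓSpecIso`. [folklore] -/
theorem appTop_comp_ΓSpecIso_inv :
    (Spec.map (CommRingCat.ofHom φ)).appTop.hom.comp (Scheme.ΓSpecIso (.of R)).inv.hom =
      (Scheme.ΓSpecIso (.of A)).inv.hom.comp φ :=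
  (congrArg CommRingCat.Hom.hom (Scheme.ΓSpecIso_inv_naturality (CommRingCat.ofHom φ))).symm

/-- **`Ĩ_J` pulls back along `Spec φ : Spec A → Spec R` to `Ĩ_{J·A}`** (Görtz–Wedhorn I,
Example 4.36: `f⁻¹(V(𝔞)) = V(𝔞B)`), for the tree's ideal sheaf `affineBlowup.idealSheaf` of an
ideal. In particular the special fibre `V(ϖ) ×_{Spec O} Spec A` of an `O`-algebra `A` is `V(ϖ_A)`.
[cite: GortzWedhorn2020, Example 4.36 (p. 139)] -/
theorem idealSheaf_comap_specMap :
    (affineBlowup.idealSheaf J).comap (Spec.map (CommRingCat.ofHom φ)) =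
      affineBlowup.idealSheaf (J.map φ) := by
  rw [affineBlowup.idealSheaf, affineBlowup.idealSheaf, comap_ofIdealTop_of_isAffine,
    Ideal.map_map, Ideal.map_map, appTop_comp_ΓSpecIso_inv]

end IdealSheaf

/-! ## Morphisms to `Spec A[I/b]` over `Spec A` -/

section Charts

variable {A : Type u} [CommRing A] (I : Ideal A) (b : A)

/-- **Cartier charts of a test scheme**: if `f : T → Spec A` pulls `V(b)` back to an effective
Cartier divisor, every point of `T` lies in an affine open `V` on which (the image of) `b` is a
non-zero-divisor of `Γ(V, 𝒪_V)` — on a chart, `b·Γ(V) = (u)` with `u` regular forces `b` regular.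
[folklore] -/
theorem exists_affineOpens_regular {T : Scheme.{u}} (f : T ⟶ Spec (.of A))
    (hf : IsEffectiveCartier ((affineBlowup.idealSheaf (Ideal.span {b})).comap f)) (x : T) :
    ∃ V : T.affineOpens, x ∈ (V : T.Opens) ∧
      (((V : T.Opens).ι ≫ f).appTop.hom.comp (Scheme.ΓSpecIso (.of A)).inv.hom) b ∈
        nonZeroDivisors Γ((V : Scheme.{u}), ⊤) := by
  obtain ⟨V, hxV, u, hu, hKV⟩ := hf x
  obtain ⟨u', hu', hspan⟩ := exists_generator_appTop (Ideal.span {b}) f V u hu hKV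
  refine ⟨V, hxV, ?_⟩
  rw [Ideal.map_span, Set.image_singleton] at hspan
  exact mem_nonZeroDivisors_of_span_eq_span hspan hu'

/-- **`I·Γ(V) ⊆ b·Γ(V)` on affine opens of a test scheme** whose preimage of `V(b)` is contained,
as a closed subscheme, in the preimage of `V(I)`. [folklore] -/
theorem map_le_span_of_comap_le {T : Scheme.{u}} (f : T ⟶ Spec (.of A))
    (hZ : (affineBlowup.idealSheaf I).comap f ≤
      (affineBlowup.idealSheaf (Ideal.span {b})).comap f)
    (V : T.affineOpens) :
    I.map (((V : T.Opens).ι ≫ f).appTop.hom.comp (Scheme.ΓSpecIso (.of A)).inv.hom) ≤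
      Ideal.span
        {(((V : T.Opens).ι ≫ f).appTop.hom.comp (Scheme.ΓSpecIso (.of A)).inv.hom) b} := by
  haveI : IsAffine (V : Scheme.{u}) := V.2
  have h1 : ((affineBlowup.idealSheaf I).comap f).comap (V : T.Opens).ι ≤
      ((affineBlowup.idealSheaf (Ideal.span {b})).comap f).comap (V : T.Opens).ι :=
    Scheme.IdealSheafData.comap_mono _ hZ
  rw [← Scheme.IdealSheafData.comap_comp, ← Scheme.IdealSheafData.comap_comp,
    affineBlowup.idealSheaf, affineBlowup.idealSheaf, comap_ofIdealTop_of_isAffine,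
    comap_ofIdealTop_of_isAffine] at h1
  have h2 := h1 ⟨⊤, isAffineOpen_top _⟩
  rw [ideal_ofIdealTop_top, ideal_ofIdealTop_top, Ideal.map_map, Ideal.map_map, Ideal.map_span,
    Set.image_singleton] at h2
  exact h2

/-- **Uniqueness of morphisms `V → Spec A[I/b]` over `Spec A` from an affine scheme on which `b`
is a non-zero-divisor** (MRR §2.3, proof, injectivity: "since `B[b⁻¹] = B[I/b][b⁻¹]` we get
`g[b⁻¹] = g'[b⁻¹]`. As `b` is a non-zero divisor in `R` … `g = g'`"; here through the tree's
`Resolution.blowupAlgebra.ringHom_ext`). [cite: MayeuxRicharzRomagny2020, §2.3 (Proposition, proof)] -/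
theorem spec_hom_ext {V : Scheme.{u}} [IsAffine V] (q : V ⟶ Spec (.of A))
    (hreg : (q.appTop.hom.comp (Scheme.ΓSpecIso (.of A)).inv.hom) b ∈ nonZeroDivisors Γ(V, ⊤))
    {g₁ g₂ : V ⟶ Spec (.of (blowupAlgebra I b))}
    (h₁ : g₁ ≫ Spec.map (CommRingCat.ofHom (algebraMap A (blowupAlgebra I b))) = q)
    (h₂ : g₂ ≫ Spec.map (CommRingCat.ofHom (algebraMap A (blowupAlgebra I b))) = q) :
    g₁ = g₂ := by
  -- the ring maps `A[I/b] → Γ(V, 𝒪_V)` of `g₁`, `g₂` both extend that of `q`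
  have key : ∀ {g : V ⟶ Spec (.of (blowupAlgebra I b))},
      g ≫ Spec.map (CommRingCat.ofHom (algebraMap A (blowupAlgebra I b))) = q →
      (g.appTop.hom.comp (Scheme.ΓSpecIso (.of (blowupAlgebra I b))).inv.hom).comp
          (algebraMap A (blowupAlgebra I b)) =
        q.appTop.hom.comp (Scheme.ΓSpecIso (.of A)).inv.hom := by
    intro g hg
    have e1 : q.appTop =
        (Spec.map (CommRingCat.ofHom (algebraMap A (blowupAlgebra I b)))).appTop ≫ g.appTop := by
      rw [← hg, Scheme.Hom.comp_appTop]
    have e2 := appTop_comp_ΓSpecIso_inv (algebraMap A (blowupAlgebra I b))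
    apply RingHom.ext
    intro a
    have e3 := RingHom.congr_fun e2 a
    simp only [RingHom.comp_apply] at e3 ⊢
    rw [← e3, e1]
    rfl
  have hψ : g₁.appTop.hom.comp (Scheme.ΓSpecIso (.of (blowupAlgebra I b))).inv.hom =
      g₂.appTop.hom.comp (Scheme.ΓSpecIso (.of (blowupAlgebra I b))).inv.hom :=
    blowupAlgebra.ringHom_ext I hreg (key h₁) (key h₂)
  have hψ' : (Scheme.ΓSpecIso (.of (blowupAlgebra I b))).inv ≫ g₁.appTop =
      (Scheme.ΓSpecIso (.of (blowupAlgebra I b))).inv ≫ g₂.appTop :=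
    CommRingCat.hom_ext hψ
  calc g₁ = V.toSpecΓ ≫ Spec.map ((Scheme.ΓSpecIso (.of (blowupAlgebra I b))).inv ≫ g₁.appTop) :=
        eq_toSpecΓ_SpecMap g₁
    _ = V.toSpecΓ ≫ Spec.map ((Scheme.ΓSpecIso (.of (blowupAlgebra I b))).inv ≫ g₂.appTop) := by
        rw [hψ']
    _ = g₂ := (eq_toSpecΓ_SpecMap g₂).symm

/-- **Local existence** (MRR §2.3, proof, surjectivity): from an affine scheme `V` on which `b`
is a non-zero-divisor and `I·Γ(V) ⊆ b·Γ(V)`, the morphism `q : V → Spec A` lifts to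
`Spec A[I/b]` — `Spec` of the ring homomorphism `A[I/b] → Γ(V, 𝒪_V)`, `x/b ↦` the unique `r`
with `q^*(x) = b·r` (the tree's `Resolution.blowupAlgebra.lift`).
[cite: MayeuxRicharzRomagny2020, §2.3 (Proposition, proof)] -/
theorem exists_specLift {V : Scheme.{u}} [IsAffine V] (q : V ⟶ Spec (.of A))
    (hreg : (q.appTop.hom.comp (Scheme.ΓSpecIso (.of A)).inv.hom) b ∈ nonZeroDivisors Γ(V, ⊤))
    (hI : I.map (q.appTop.hom.comp (Scheme.ΓSpecIso (.of A)).inv.hom) ≤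
      Ideal.span {(q.appTop.hom.comp (Scheme.ΓSpecIso (.of A)).inv.hom) b}) :
    ∃ g : V ⟶ Spec (.of (blowupAlgebra I b)),
      g ≫ Spec.map (CommRingCat.ofHom (algebraMap A (blowupAlgebra I b))) = q := by
  refine ⟨V.toSpecΓ ≫ Spec.map (CommRingCat.ofHom (blowupAlgebra.lift I hreg hI)), ?_⟩
  rw [Category.assoc, ← Spec.map_comp]
  conv_rhs => rw [eq_toSpecΓ_SpecMap q]
  congr 2
  ext a
  change blowupAlgebra.lift I hreg hI (algebraMap A (blowupAlgebra I b) a) =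
    q.appTop.hom ((Scheme.ΓSpecIso (.of A)).inv.hom a)
  rw [blowupAlgebra.lift_algebraMap]
  rfl

/-- **Uniqueness of morphisms to `Spec A[I/b]` over `Spec A`** from any `T` on which `V(b)` pulls
back to an effective Cartier divisor (MRR §2.3, injectivity, glued: two such morphisms agree on
the Cartier charts of `T`, by `spec_hom_ext`). [cite: MayeuxRicharzRomagny2020, §2.3 (Proposition, proof)] -/
theorem spec_hom_ext_of_isEffectiveCartier {T : Scheme.{u}} (f : T ⟶ Spec (.of A))
    (hf : IsEffectiveCartier ((affineBlowup.idealSheaf (Ideal.span {b})).comap f))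
    {g₁ g₂ : T ⟶ Spec (.of (blowupAlgebra I b))}
    (h₁ : g₁ ≫ Spec.map (CommRingCat.ofHom (algebraMap A (blowupAlgebra I b))) = f)
    (h₂ : g₂ ≫ Spec.map (CommRingCat.ofHom (algebraMap A (blowupAlgebra I b))) = f) :
    g₁ = g₂ := by
  choose V hxV hreg using fun x => exists_affineOpens_regular b f hf x
  have hcover : ⨆ x, (V x : T.Opens) = ⊤ :=
    top_le_iff.mp fun x _ => Opens.mem_iSup.mpr ⟨x, hxV x⟩
  let 𝒱 := T.openCoverOfIsOpenCover (fun x => (V x : T.Opens)) (.mk hcover)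
  apply Scheme.Cover.hom_ext 𝒱
  intro x
  change (V x : T.Opens).ι ≫ g₁ = (V x : T.Opens).ι ≫ g₂
  haveI : IsAffine ((V x : T.Opens) : Scheme.{u}) := (V x).2
  exact spec_hom_ext I b ((V x : T.Opens).ι ≫ f) (hreg x) (by rw [Category.assoc, h₁])
    (by rw [Category.assoc, h₂])

end Charts

/-! ## `Spec A[I/b] → Spec A` is a dilatation -/

section Main

variable {A : Type u} [CommRing A] (I : Ideal A) (b : A)

/-- **The affine dilatation has the universal property** (Mayeux–Richarz–Romagny §2.1,
Definition, with §2.3, Proposition, and §2.2, second Lemma, in the affine principal case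
`X = Spec B`, `J = (b)`): `Spec A[I/b] → Spec A` is a dilatation of `Spec A` in `V(I)` along
`V(b)` — (i) `V(b)` pulls back to the effective Cartier divisor `V(b) ⊆ Spec A[I/b]` (`b` is a
non-zero-divisor of `A[I/b]`, MRR (2.1)); (ii) it is contained in the preimage of `V(I)`
(`I·A[I/b] ⊆ b·A[I/b]`, MRR (2.2)); (iii) every `f : T → Spec A` with these two properties factors
uniquely through `Spec A[I/b]` (MRR §2.3, proof: Zariski-locally on `T` by the ring-level
universal property of `B[I/b]`, glued). No hypothesis `b ∈ I`.
[cite: MayeuxRicharzRomagny2020, §2.3 (Proposition)] -/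
theorem isDilatation_specMap_blowupAlgebra :
    IsDilatation (Spec.map (CommRingCat.ofHom (algebraMap A (blowupAlgebra I b))))
      (affineBlowup.idealSheaf I) (affineBlowup.idealSheaf (Ideal.span {b})) := by
  have e := appTop_comp_ΓSpecIso_inv (algebraMap A (blowupAlgebra I b))
  refine ⟨?_, ?_, ?_⟩
  · -- (i) `V(b) ×_X X' = V(b·A[I/b])`, and `b` is regular in `A[I/b]`
    intro x
    refine ⟨⟨⊤, isAffineOpen_top _⟩, trivial,
      (Scheme.ΓSpecIso (.of (blowupAlgebra I b))).inv.hom (algebraMap A (blowupAlgebra I b) b),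
      ?_, ?_⟩
    · have hinj : Function.Injective (Scheme.ΓSpecIso (.of (blowupAlgebra I b))).hom.hom :=
        (Scheme.ΓSpecIso (.of (blowupAlgebra I b))).commRingCatIsoToRingEquiv.injective
      refine mem_nonZeroDivisors_of_injective hinj ?_
      rw [← CommRingCat.comp_apply, Iso.inv_hom_id]
      exact algebraMap_mem_nonZeroDivisors_blowupAlgebra
    · rw [affineBlowup.idealSheaf, comap_ofIdealTop_of_isAffine, ideal_ofIdealTop_top,
        Ideal.map_map, e, Ideal.map_span, Set.image_singleton]
      rfl
  · -- (ii) `I·A[I/b] ⊆ b·A[I/b]`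
    rw [affineBlowup.idealSheaf, affineBlowup.idealSheaf, comap_ofIdealTop_of_isAffine,
      comap_ofIdealTop_of_isAffine]
    refine Scheme.IdealSheafData.le_of_isAffine ?_
    rw [ideal_ofIdealTop_top, ideal_ofIdealTop_top, Ideal.map_map, Ideal.map_map, e,
      ← Ideal.map_map, ← Ideal.map_map]
    refine Ideal.map_mono ?_
    rw [Ideal.map_span, Set.image_singleton]
    exact map_blowupAlgebra_le_span I b
  · -- (iii) the universal property: local lifts on the Cartier charts of `T`, glued
    intro T f hf hZ
    choose V hxV hreg using fun x => exists_affineOpens_regular b f hf x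
    have hcover : ⨆ x, (V x : T.Opens) = ⊤ :=
      top_le_iff.mp fun x _ => Opens.mem_iSup.mpr ⟨x, hxV x⟩
    let 𝒱 := T.openCoverOfIsOpenCover (fun x => (V x : T.Opens)) (.mk hcover)
    -- local lifts
    have hlift : ∀ x, ∃ g : ((V x : T.Opens) : Scheme.{u}) ⟶ Spec (.of (blowupAlgebra I b)),
        g ≫ Spec.map (CommRingCat.ofHom (algebraMap A (blowupAlgebra I b))) =
          (V x : T.Opens).ι ≫ f := fun x =>
      haveI : IsAffine ((V x : T.Opens) : Scheme.{u}) := (V x).2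
      exists_specLift I b ((V x : T.Opens).ι ≫ f) (hreg x) (map_le_span_of_comap_le I b f hZ (V x))
    choose g hgπ using hlift
    -- compatibility on overlaps (uniqueness of morphisms to `Spec A[I/b]`)
    have hcompat : ∀ x y : T,
        pullback.fst ((V x : T.Opens).ι) ((V y : T.Opens).ι) ≫ g x = pullback.snd _ _ ≫ g y := by
      intro x y
      refine spec_hom_ext_of_isEffectiveCartier I b
        (pullback.fst ((V x : T.Opens).ι) ((V y : T.Opens).ι) ≫ (V x : T.Opens).ι ≫ f) ?_ ?_ ?_
      · rw [← Category.assoc, Scheme.IdealSheafData.comap_comp]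
        exact hf.comap_of_isOpenImmersion _
      · rw [Category.assoc, hgπ]
      · rw [Category.assoc, hgπ, ← Category.assoc, ← pullback.condition, Category.assoc]
    have hGπ : 𝒱.glueMorphisms g hcompat ≫
        Spec.map (CommRingCat.ofHom (algebraMap A (blowupAlgebra I b))) = f := by
      apply Scheme.Cover.hom_ext 𝒱
      intro x
      change (V x : T.Opens).ι ≫ 𝒱.glueMorphisms g hcompat ≫
        Spec.map (CommRingCat.ofHom (algebraMap A (blowupAlgebra I b))) = (V x : T.Opens).ι ≫ f
      rw [← Category.assoc]
      have : (V x : T.Opens).ι ≫ 𝒱.glueMorphisms g hcompat = g x :=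
        Scheme.Cover.ι_glueMorphisms 𝒱 g hcompat x
      rw [this, hgπ]
    exact ⟨𝒱.glueMorphisms g hcompat, hGπ,
      fun g' hg' => spec_hom_ext_of_isEffectiveCartier I b f hf hg' hGπ⟩

/-- Hence every affine scheme admits the dilatation in `V(I)` along `V(b)` for all `I`, `b`
(existence, affine principal case of MRR §2.1). [cite: MayeuxRicharzRomagny2020, §2.1 (Definition)] -/
theorem exists_isDilatation_spec :
    ∃ (X' : Scheme.{u}) (π : X' ⟶ Spec (.of A)),
      IsDilatation π (affineBlowup.idealSheaf I) (affineBlowup.idealSheaf (Ideal.span {b})) :=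
  ⟨_, _, isDilatation_specMap_blowupAlgebra I b⟩

end Main

/-! ## Over a base ring: the dilatation of a closed subscheme of the divisor `V(ϖ)` -/

section Base

variable {O : Type u} [CommRing O] (ϖ : O) {A : Type u} [CommRing A] [Algebra O A] (I : Ideal A)

/-- **The tree's affine dilatation `Spec A[I/ϖ] → Spec A` over a base ring `O` with `ϖ ∈ O`
(`Dilatations.dilatation.specMap`; for `O` a discrete valuation ring with uniformizer `ϖ` and
`ϖ ∈ I` this is the dilatation of `Y = V(I) ⊆ X_k` in `X = Spec A` of Bosch–Lütkebohmert–Raynaud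
§3.2) is a dilatation of `Spec A` in `V(I)` along the divisor `V(ϖ_A) = X ×_{Spec O} V(ϖ)`** in the
sense of the universal property `IsDilatation` (MRR §2.3).
[cite: MayeuxRicharzRomagny2020, §2.3 (Proposition)] -/
theorem isDilatation_dilatationSpecMap :
    IsDilatation (Dilatations.dilatation.specMap ϖ I) (affineBlowup.idealSheaf I)
      (affineBlowup.idealSheaf (Ideal.span {algebraMap O A ϖ})) :=
  isDilatation_specMap_blowupAlgebra I (algebraMap O A ϖ)

/-- The same, with the divisor written as the preimage `X ×_{Spec O} V(ϖ)` of `V(ϖ) ⊆ Spec O`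
under the structure morphism (BLR §3.2: `D` = the special fibre `X_k` when `O` is a discrete
valuation ring with uniformizer `ϖ`). [cite: MayeuxRicharzRomagny2020, §2.3 (Proposition)] -/
theorem isDilatation_dilatationSpecMap_comap :
    IsDilatation (Dilatations.dilatation.specMap ϖ I) (affineBlowup.idealSheaf I)
      ((affineBlowup.idealSheaf (Ideal.span {ϖ})).comap
        (Spec.map (CommRingCat.ofHom (algebraMap O A)))) := by
  rw [idealSheaf_comap_specMap, Ideal.map_span, Set.image_singleton]
  exact isDilatation_dilatationSpecMap ϖ I

end Base

end Literature.AlgebraicGeometry.NeronModels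

end
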